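import Mathlib
import Literature.Barriers.ValiantsHypothesis.AlgebraicNaturalProofs
import Summits.ValiantsHypothesis.ValiantsHypothesis.Theorems.BarrierLeverPartitionMinorsHitByVPHiddenStatesCoefficients

/-!
# Route BarrierLever — item `PartitionMinorsHitByVP` (stmt-ValiantsHypothesis-19717):
# the HIDDEN-STATE witness, part 2/2 — size, truncation, and the CAUCHY–BINET DOOR

Helper file (`--supports stmt-ValiantsHypothesis-19717`; cell valiant-natproofs, rung V4, 𝒟-side of
door (c); prover seat val-np-p3 gen 6). Definition-free. Closes NO item.

With `x_a = X (castAdd h a)`, `y_c = X (natAdd h c)`, `K` hidden states, a table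
`tab : Option (Fin K) → Fin (h+h) → ℂ` and weights `λ`, the witness of part 1 is
`F(tab, λ) = ∏_v (1 + tab none v · X_v) · ∏_k (1 + λ_k ∏_v (1 + tab (some k) v · X_v))`, truncated to degree `2h`.

* `complexity_hiddenStateF_le` — `L(F) ≤ 6h + K(6h+2) + K + 1`.
* **`partitionMinor_hit_of_hiddenStates`** (THE DOOR, explicit size) and
  **`partitionMinor_hit_of_hiddenStates_mem`** (`K ≤ h·h`, `h ≥ 5` ⇒ inside `SmallCircuits ℂ (h+h) 6`):
  a layout `(u, w)` of size `r` is hit as soon as, for SOME injective threshold family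
  `e : Fin r → Finset (Fin K)` (the `r` lightest subsets for an additive weight `J ↦ Σ_{k∈J} wt k`) and SOME
  tables `tx, ty : Option (Fin K) → Fin h → ℂ`, BOTH additive matrices
  `[∏_{a ∈ u i} (tx none a + Σ_{q ∈ e k} tx (some q) a)]_{i,k}` and `[∏_{c ∈ w j} (ty none c + Σ_{q ∈ e k} ty (some q) c)]_{j,k}`
  are nonsingular: on the layout the partition matrix of `F` is `A · diag(λ^J) · Bᵀ` over all `J ⊆ Fin K`
  (`coeff_partition_hiddenStateF`), and with `λ_k = t₀^{wt k}` the `t`-leading coefficient of its determinant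
  is `det A[·,e] · det B[·,e]` (`exists_eval_det_hiddenSum_ne_zero`).

USE (cell record). Compared with the additive door (`…AdditiveDoor`: rows arbitrary, columns must carry the
structure, e.g. binary-contiguous by `…SubsetSumFrobenius`), here BOTH sides are the «arbitrary» side of an
additive matrix against ONE auxiliary family of our choosing. The natural choice is the Hamming ball `B(K, s)`
completed by the colex-initial segment of layer `s+1` (sub-cubes are capacity-dead; balls escape every Hilbert
obstruction of `…AdditiveObstruction` once `K ≥ h`). CONJECTURE Q* (seat val-np-p3 g6; exhaustive at `h = 4`:
all 65 535 column families; kit j277989): for `K = h`, EVERY family of `r` distinct subsets of `Fin h` has a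
nonsingular additive matrix against that family for a generic table. Q* for `u` and for `w` ⇒ item 19717 here.

WHAT THIS IS NOT: the witness is not a product of `2h` affine forms (nothing on CPM, items 20172/20195); no
claim on which families satisfy the hypothesis; nothing on crux 14610 or VP vs VNP.
-/

set_option linter.dupNamespace false

namespace Summit.ValiantsHypothesis.ValiantsHypothesis.Theorems.BarrierLever.HiddenStates

open Finset MvPolynomial Matrix
open Literature.Barriers.ValiantsHypothesis Literature.Computability.AlgebraicComplexity
open Summit.ValiantsHypothesis.ValiantsHypothesis.Theorems.BarrierLever.AdditiveDoor
  (truncation_spec degree_partitionExpo_le complexity_one_add_C_mul_X_le)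

noncomputable section

/-! ## 4. The door -/

section Door

variable {h : ℕ}

/-- `L(∏_v (1 + t_v · X_v)) ≤ 3·(h+h)` over the variables `Fin (h + h)`. -/
theorem complexity_elemProd_le (t : Fin (h + h) → ℂ) :
    complexity (∏ v : Fin (h + h), (1 + C (t v) * X v) : MvPolynomial (Fin (h + h)) ℂ) ≤
      3 * (h + h) := by
  calc complexity (∏ v : Fin (h + h), (1 + C (t v) * X v) : MvPolynomial (Fin (h + h)) ℂ)
      ≤ ∑ v : Fin (h + h), complexity ((1 + C (t v) * X v : MvPolynomial (Fin (h + h)) ℂ)) +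
          (Finset.univ : Finset (Fin (h + h))).card := complexity_finset_prod_le _ _
    _ ≤ ∑ _v : Fin (h + h), 2 + (Finset.univ : Finset (Fin (h + h))).card := by
        gcongr with v _; exact complexity_one_add_C_mul_X_le _ _
    _ = 3 * (h + h) := by simp; ring

/-- **Size of the hidden-state witness**: `L(F(tab, λ)) ≤ 3(2h) + K(3(2h) + 3) + 1` for `K` states. -/
theorem complexity_hiddenStateF_le {K : ℕ} (tab : Option (Fin K) → Fin (h + h) → ℂ) (lam : Fin K → ℂ) :
    complexity ((∏ v : Fin (h + h), (1 + C (tab none v) * X v)) *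
        ∏ k : Fin K, (1 + C (lam k) * ∏ v : Fin (h + h), (1 + C (tab (some k) v) * X v)) :
        MvPolynomial (Fin (h + h)) ℂ) ≤
      3 * (h + h) + (K * (3 * (h + h) + 2) + K) + 1 := by
  have hblock : ∀ k : Fin K, complexity ((1 + C (lam k) *
      ∏ v : Fin (h + h), (1 + C (tab (some k) v) * X v)) : MvPolynomial (Fin (h + h)) ℂ) ≤
      3 * (h + h) + 2 := by
    intro k
    calc complexity ((1 + C (lam k) * ∏ v : Fin (h + h), (1 + C (tab (some k) v) * X v)) :
          MvPolynomial (Fin (h + h)) ℂ)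
        ≤ complexity (1 : MvPolynomial (Fin (h + h)) ℂ) +
            complexity (C (lam k) * ∏ v : Fin (h + h), (1 + C (tab (some k) v) * X v) :
              MvPolynomial (Fin (h + h)) ℂ) + 1 := complexity_add_le_holds _ _
      _ ≤ 0 + (complexity (C (lam k) : MvPolynomial (Fin (h + h)) ℂ) +
            complexity (∏ v : Fin (h + h), (1 + C (tab (some k) v) * X v) :
              MvPolynomial (Fin (h + h)) ℂ) + 1) + 1 := by
          gcongr
          · rw [← C_1, complexity_C_holds]
          · exact complexity_mul_le_holds _ _
      _ ≤ 0 + (0 + 3 * (h + h) + 1) + 1 := by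
          rw [complexity_C_holds]
          gcongr
          exact complexity_elemProd_le _
      _ = 3 * (h + h) + 2 := by ring
  calc complexity ((∏ v : Fin (h + h), (1 + C (tab none v) * X v)) *
        ∏ k : Fin K, (1 + C (lam k) * ∏ v : Fin (h + h), (1 + C (tab (some k) v) * X v)) :
        MvPolynomial (Fin (h + h)) ℂ)
      ≤ complexity (∏ v : Fin (h + h), (1 + C (tab none v) * X v) : MvPolynomial (Fin (h + h)) ℂ) +
          complexity (∏ k : Fin K, (1 + C (lam k) *
            ∏ v : Fin (h + h), (1 + C (tab (some k) v) * X v)) : MvPolynomial (Fin (h + h)) ℂ) + 1 :=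
        complexity_mul_le_holds _ _
    _ ≤ 3 * (h + h) + (∑ k : Fin K, complexity ((1 + C (lam k) *
            ∏ v : Fin (h + h), (1 + C (tab (some k) v) * X v)) : MvPolynomial (Fin (h + h)) ℂ) +
          (Finset.univ : Finset (Fin K)).card) + 1 := by
        gcongr
        · exact complexity_elemProd_le _
        · exact complexity_finset_prod_le _ _
    _ ≤ 3 * (h + h) + (∑ _k : Fin K, (3 * (h + h) + 2) + (Finset.univ : Finset (Fin K)).card) + 1 := by
        gcongr with k _; exact hblock k
    _ = 3 * (h + h) + (K * (3 * (h + h) + 2) + K) + 1 := by simp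

/-- **THE HIDDEN-STATE DOOR (explicit size).** Let `(u, w)` be a layout of size `r`, `e : Fin r → Finset (Fin K)`
an injective THRESHOLD family for the additive weight `J ↦ Σ_{k∈J} wt k` (every subset outside its range is
heavier than every member), and `tx, ty : Option (Fin K) → Fin h → ℂ` tables whose additive matrices
`[∏_{a ∈ u i} (tx none a + Σ_{q ∈ e k} tx (some q) a)]_{i,k}` and `[∏_{c ∈ w j} (ty none c + Σ_{q ∈ e k} ty (some q) c)]_{j,k}`
are BOTH nonsingular. Then some `f` of degree `≤ 2h` and size `≤ (2h+2)²(6h + K(6h+2) + K + 1) + 2h + 1` has a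
nonsingular partition matrix on `(u, w)`. -/
theorem partitionMinor_hit_of_hiddenStates (h K r : ℕ) (u w : Fin r → Finset (Fin h))
    (e : Fin r → Finset (Fin K)) (he : Function.Injective e) (wt : Fin K → ℕ)
    (hthr : ∀ J : Finset (Fin K), J ∉ Set.range e → ∀ i, ∑ k ∈ e i, wt k < ∑ k ∈ J, wt k)
    (tx ty : Option (Fin K) → Fin h → ℂ)
    (hx : (Matrix.of fun i k : Fin r => ∏ a ∈ u i, (tx none a + ∑ q ∈ e k, tx (some q) a)).det ≠ 0)
    (hy : (Matrix.of fun j k : Fin r => ∏ c ∈ w j, (ty none c + ∑ q ∈ e k, ty (some q) c)).det ≠ 0) :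
    ∃ f : MvPolynomial (Fin (h + h)) ℂ, f.totalDegree ≤ h + h ∧
      complexity f ≤ (h + h + 2) ^ 2 * (3 * (h + h) + (K * (3 * (h + h) + 2) + K) + 1) + (h + h + 1) ∧
      (Matrix.of fun i j : Fin r => MvPolynomial.coeff
        (∑ a ∈ u i, Finsupp.single (Fin.castAdd h a) 1 +
          ∑ c ∈ w j, Finsupp.single (Fin.natAdd h c) 1) f).det ≠ 0 := by
  classical
  -- the two additive matrices over ALL hidden subsets
  set A : Matrix (Fin r) (Finset (Fin K)) ℂ :=
    Matrix.of fun i J => ∏ a ∈ u i, (tx none a + ∑ q ∈ J, tx (some q) a) with hA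
  set B : Matrix (Fin r) (Finset (Fin K)) ℂ :=
    Matrix.of fun j J => ∏ c ∈ w j, (ty none c + ∑ q ∈ J, ty (some q) c) with hB
  have hAe : (A.submatrix id e).det ≠ 0 := hx
  have hBe : (B.submatrix id e).det ≠ 0 := hy
  obtain ⟨t₀, ht₀⟩ := exists_eval_det_hiddenSum_ne_zero A B (fun J => ∑ k ∈ J, wt k) e he hthr hAe hBe
  -- the witness: combined table on `Fin (h + h)`, weights `λ_k = t₀ ^ wt k`
  set tab : Option (Fin K) → Fin (h + h) → ℂ := fun o v => Fin.addCases (tx o) (ty o) v with htab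
  set lam : Fin K → ℂ := fun k => t₀ ^ wt k with hlam
  set F : MvPolynomial (Fin (h + h)) ℂ := (∏ v : Fin (h + h), (1 + C (tab none v) * X v)) *
    ∏ k : Fin K, (1 + C (lam k) * ∏ v : Fin (h + h), (1 + C (tab (some k) v) * X v)) with hF
  obtain ⟨hdeg, hcoeff, hsize⟩ := truncation_spec F (h + h)
  refine ⟨∑ d ∈ Finset.range (h + h + 1), homogeneousComponent d F, hdeg, ?_, ?_⟩
  · exact hsize.trans (by have := complexity_hiddenStateF_le tab lam; rw [← hF] at this; gcongr)
  · have hmat : (Matrix.of fun i j : Fin r => MvPolynomial.coeff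
        (∑ a ∈ u i, Finsupp.single (Fin.castAdd h a) 1 +
          ∑ c ∈ w j, Finsupp.single (Fin.natAdd h c) 1)
        (∑ d ∈ Finset.range (h + h + 1), homogeneousComponent d F)) =
        Matrix.of fun i j : Fin r => ∑ J : Finset (Fin K), A i J * B j J * t₀ ^ (∑ k ∈ J, wt k) := by
      refine Matrix.ext fun i j => ?_
      rw [Matrix.of_apply, Matrix.of_apply, hcoeff _ (degree_partitionExpo_le _ _), hF,
        coeff_partition_hiddenStateF]
      refine Finset.sum_congr rfl fun J _ => ?_
      have hl : ∏ k ∈ J, lam k = t₀ ^ (∑ k ∈ J, wt k) := by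
        rw [hlam]; exact Finset.prod_pow_eq_pow_sum J wt t₀
      rw [hl, hA, hB]
      simp only [Matrix.of_apply, htab, Fin.addCases_left, Fin.addCases_right]
      ring
    rw [hmat]
    exact ht₀

/-- **THE HIDDEN-STATE DOOR (class form).** With `K ≤ h·h` hidden states and `h ≥ 5` the witness lies in
`SmallCircuits ℂ (h+h) 6`. -/
theorem partitionMinor_hit_of_hiddenStates_mem (h K r : ℕ) (hh : 5 ≤ h) (hK : K ≤ h * h)
    (u w : Fin r → Finset (Fin h))
    (e : Fin r → Finset (Fin K)) (he : Function.Injective e) (wt : Fin K → ℕ)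
    (hthr : ∀ J : Finset (Fin K), J ∉ Set.range e → ∀ i, ∑ k ∈ e i, wt k < ∑ k ∈ J, wt k)
    (tx ty : Option (Fin K) → Fin h → ℂ)
    (hx : (Matrix.of fun i k : Fin r => ∏ a ∈ u i, (tx none a + ∑ q ∈ e k, tx (some q) a)).det ≠ 0)
    (hy : (Matrix.of fun j k : Fin r => ∏ c ∈ w j, (ty none c + ∑ q ∈ e k, ty (some q) c)).det ≠ 0) :
    ∃ f ∈ SmallCircuits ℂ (h + h) 6,
      (Matrix.of fun i j : Fin r => MvPolynomial.coeff
        (∑ a ∈ u i, Finsupp.single (Fin.castAdd h a) 1 +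
          ∑ c ∈ w j, Finsupp.single (Fin.natAdd h c) 1) f).det ≠ 0 := by
  obtain ⟨f, hdeg, hsize, hf⟩ := partitionMinor_hit_of_hiddenStates h K r u w e he wt hthr tx ty hx hy
  refine ⟨f, ⟨hdeg, hsize.trans ?_⟩, hf⟩
  have e1 : h + h + 2 ≤ 3 * h := by omega
  have e2 : 3 * (h + h) + (K * (3 * (h + h) + 2) + K) + 1 ≤ 7 * (h * h * h) := by
    have : K * (3 * (h + h) + 2) + K ≤ h * h * (3 * (h + h) + 2) + h * h := by gcongr
    nlinarith
  have e3 : h + h + 1 ≤ h * h * h * h * h := by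
    have e3a : h + h + 1 ≤ h * h := by nlinarith
    calc h + h + 1 ≤ h * h := e3a
      _ ≤ h * h * (h * h * h) := Nat.le_mul_of_pos_right _ (by positivity)
      _ = h * h * h * h * h := by ring
  calc (h + h + 2) ^ 2 * (3 * (h + h) + (K * (3 * (h + h) + 2) + K) + 1) + (h + h + 1)
      ≤ (3 * h) ^ 2 * (7 * (h * h * h)) + h * h * h * h * h := by gcongr
    _ = 64 * (h * h * h * h * h) := by ring
    _ ≤ (h + h) ^ 6 := by
        have : (h + h) ^ 6 = 64 * (h * h * h * h * h) * h := by ring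
        rw [this]
        nlinarith

end Door

end

end Summit.ValiantsHypothesis.ValiantsHypothesis.Theorems.BarrierLever.HiddenStates
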